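/-
K2-LIT rung 3 ∕ ED. 2 of ★ p855363 (prover seat hodgecm-mathlib-K2E1-p05, gen 2): 5R FOR A SUPERCUSPIDAL `ρ₀` WITH (H1) AND (H2) DISCHARGED BY THE POINCARÉ SERIES.
-/
import Summits.HodgeConjecture.HodgeConjecture.Theorems.K2E1GlobaliseSupercuspidalU2            -- ★ p855363 `globaliseSupercuspidal_of_cuspidal` → ★ p855275 (node), ★ p855330 ((H3))
import Summits.HodgeConjecture.HodgeConjecture.Theorems.K2E1PoincareSeriesH1PackagePoincare     -- ★ p855494 (H1) `exists_h1Package_poincare` (K2E1-p07)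
import Summits.HodgeConjecture.HodgeConjecture.Theorems.K2E1PoincareSeriesCuspidalGlueU2         -- ★ p855468 → ★ p855440 (H2) `toLp_poincare_mem_cuspidalSubspace`
import HarnessLib

/-!
# 5R for a supercuspidal `ρ₀`: the Poincaré series discharges (H1) and (H2)

ED. 2 of ★ p855363 `K2E1GlobaliseSupercuspidalU2.globaliseSupercuspidal_of_cuspidal` (dealer ruling K2E1-plan 23:02:11Z, option (α)).  The hypothesis
list of ★ p855363 was {(H1) Poincaré vector `F`, (H2) `F ∈ L²_cusp(𝔓)`, (H4) GGPS by name, (T) finite-component token}.  Here: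

* (H1) is DISCHARGED by ★ p855494 `exists_h1Package_poincare` (K2E1-p07): it produces the pure tensor `φ = c_u ⊗ 𝟙_{K^v} ⊗ f_∞ ∈ C_c(U(Φ)(𝔸))`
  (as the factorisation `φ(y) = Ψ_f(y) · B (ρ y_v u) u`) whose Poincaré series `F = P_φ ∈ L²` is `≠ 0`, fixed by `R_v(e)` and by `U(Φ)(𝒪_w)` for `w ≠ v`;
* (H2) is DISCHARGED by ★ p855440 `toLp_poincare_mem_cuspidalSubspace` (this seat): `P_φ ∈ L²_cusp(𝔓)` as soon as **(A)** `φ` is adelically cuspidal along every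
  radical of `𝔓` (`∫_{N_i(𝔸)} φ(x u⁻¹ y) du = 0`) and **(B)** `N_i(K)` has finite covolume in `N_i(𝔸)`.

RESIDUAL HYPOTHESES of `globaliseSupercuspidal_of_poincare` (honest list): (H4) `CuspidalSpectrumDiscrete μH 𝔓` BY NAME (Gelfand–Graev–Piatetski-Shapiro);
(T) the finite-component token of ★ p855275 verbatim (⟸ ★ p855424 (L1)+(L2)); **(A)** for the pure tensors of ★ p855494's shape, as the binder `hA`
(⟸ the local period vanishing `hcu` of the supercuspidal coefficient — ★ `K2E1SupercuspidalUnipotentPeriodVanishing`, K2E1-p08 — composed with ★ p855468 §1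
`integral_translate_inv_eq_zero_of_subgroup` along the closed `v`-component of the radical); **(B)** as the binder `hB` (⟸ ★ p855468 §2 `finiteCovolume_of_isCompact`
and the compactness of `N_i(K)\N_i(𝔸)`, ★ `compactSpace_adeleQuotient`).  No (H1), no (H2), no (H3).

The place homomorphisms are the CANONICAL ones `j_w = inclPlaceAdelic_w ∘ (localPiEquiv_w)⁻¹` of ★ p855494 (spelled out; `jl := j` in ★ p855363).
-/

set_option autoImplicit false

set_option linter.dupNamespace false

open MeasureTheory Filter Topology CompactlySupported NumberField IsDedekindDomain
open scoped ComplexConjugate InnerProductSpace ENNReal Classical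
open Literature.NumberTheory.Automorphic Literature.NumberTheory.Automorphic.UnitaryGroup Representation
open Summit.HodgeConjecture.HodgeConjecture.Cruxes.H413.F0P3GlobalPacketDiscrete (cmOccursInDiscreteSpectrum)
open Summit.HodgeConjecture.HodgeConjecture.Cruxes.H413.K2E1GlobaliseSupercuspidalU2 (globaliseSupercuspidal_of_cuspidal)
open Summit.HodgeConjecture.HodgeConjecture.Cruxes.H413.K2E1PoincareSeriesH1PackagePoincare (exists_h1Package_poincare)
open Summit.HodgeConjecture.HodgeConjecture.Cruxes.H413.K2E1PoincareSeriesCompactSupport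
open Summit.HodgeConjecture.HodgeConjecture.Cruxes.H413.K2E1PoincareSeriesCuspidal (toLp_poincare_mem_cuspidalSubspace)

namespace Summit.HodgeConjecture.HodgeConjecture.Cruxes.H413.K2E1GlobaliseSupercuspidalU2Poincare

section General

variable (L : Type) [Field L] [NumberField L] [IsCMField L] (Φ : Matrix (Fin 2) (Fin 2) L) (v : HeightOneSpectrum (𝓞 ↥(maximalRealSubfield L)))
  [NonarchimedeanGroup ((cmDatum L 2 Φ).Local v)] [LocallyCompactSpace ((cmDatum L 2 Φ).Local v)] [T2Space ((cmDatum L 2 Φ).Local v)]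
  [MeasurableSpace ((cmDatum L 2 Φ).Local v)] [BorelSpace ((cmDatum L 2 Φ).Local v)]
  [MeasurableSpace (cmDatum L 2 Φ).Adelic] [BorelSpace (cmDatum L 2 Φ).Adelic]
  {V : Type} [AddCommGroup V] [Module ℂ V] {ρ : Representation ℂ ((cmDatum L 2 Φ).Local v) V} {B : V →ₗ⋆[ℂ] V →ₗ[ℂ] ℂ}
  [ρ.IsIrreducible] (hadm : ρ.IsAdmissible) (hsc : ρ.IsSupercuspidal)
  (hZ : IsCompact (Subgroup.center ((cmDatum L 2 Φ).Local v) : Set ((cmDatum L 2 Φ).Local v)))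
  (hBsymm : B.IsSymm) (hBpos : ∀ x : V, x ≠ 0 → 0 < (B x x).re)
  (hBinv : ∀ (g : (cmDatum L 2 Φ).Local v) (x y : V), B (ρ g x) (ρ g y) = B x y)
  (ν : Measure ((cmDatum L 2 Φ).Local v)) [ν.IsHaarMeasure] [ν.IsInvInvariant] {u : V} (hu : u ≠ 0)
  (e : C_c((cmDatum L 2 Φ).Local v, ℂ)) (he : ∀ g, e g = ((((∫ y, ‖B (ρ y u) u‖ ^ 2 ∂ν) / (B u u).re : ℝ) : ℂ))⁻¹ * B (ρ g u) u)
  (μH : Measure (adelicGroupData (↥(maximalRealSubfield L)) L (IsCMField.complexConj L) 2 Φ).automorphicQuotient)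
  [(adelicGroupData (↥(maximalRealSubfield L)) L (IsCMField.complexConj L) 2 Φ).IsAutomorphicMeasure μH]
  (𝔓 : (cmDatum L 2 Φ).ParabolicUnipotentData)

-- 2× the default budget: the closing `exact` identifies the two (definitionally equal, ★ `adelicGroupData_eq_cmDatum : _ = _ := rfl`) currencies
-- `cmDatum L 2 Φ` (★ p855494) and `adelicGroupData L⁺ L c 2 Φ` (★ p855363) inside the `L²`-operator terms; measured 32 s wall on the farm.
set_option maxHeartbeats 400000 in
include hadm hsc hZ hBsymm hBpos hBinv hu he in
/-- **5R FOR A SUPERCUSPIDAL `ρ₀` FROM THE POINCARÉ SERIES** (ED. 2 of ★ p855363; route S2, [Rogawski1990, §13.8 p. 218 (i)–(iii); Gelbart1975, §10]).  Frame of ★ p855363 with the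
CANONICAL place homomorphisms `j_w`; `ρ` irreducible admissible supercuspidal with compact centre and invariant inner product `B`, `u ≠ 0`, idempotent `e`; `μH` automorphic; `𝔓` any
family of unipotent radicals.  HYPOTHESES: **(A)** `hA`: every pure tensor `φ(y) = Ψ_f(y) · B (ρ y_v u) u` of ★ p855494's shape is adelically cuspidal along every radical of `𝔓`;
**(B)** `hB`: fundamental domains of `N_i(K)` in `N_i(𝔸)` have finite Haar measure; **(H4)** `CuspidalSpectrumDiscrete μH 𝔓` BY NAME; **(T)** the finite-component token.  (H1) is ★ p855494,
(H2) is ★ p855440, (H3) is ★ p855330 — none is a hypothesis.  CONCLUSION = the consequent of `sig_K2E1GlobaliseSquareIntegrableU2R` for `ρ₀ := [ρ]`.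
[cite: Rogawski1990, §13.8 p. 218 (i)–(iii)] [cite: Gelbart1975, §10 p. 153] [cite: GelfandGraevPiatetskiShapiro1969, Ch. 1 §4] [cite: BorelJacquet1979, §4.4–4.6] -/
theorem globaliseSupercuspidal_of_poincare (hjv : Continuous (((MonoidHom.id ((cmDatum L 2 Φ).Adelic)).comp ((inclPlaceAdelic (↥(maximalRealSubfield L)) L (IsCMField.complexConj L) 2 Φ v).comp (localPiEquiv L (IsCMField.complexConj L) 2 Φ v).symm.toMulEquiv.toMonoidHom)).comp (MonoidHom.id ((cmDatum L 2 Φ).Local v))))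
    -- (A) adelic cuspidality of the pure tensors `c_u ⊗ 𝟙_{K^v} ⊗ f` along every radical of `𝔓`
    (hA : ∀ (f : arch (↥(maximalRealSubfield L)) L (IsCMField.complexConj L) 2 Φ → ℂ) (φ : C_c((cmDatum L 2 Φ).Adelic, ℂ)),
      (∀ y : (cmDatum L 2 Φ).Adelic, φ y = (if ∀ w, w ≠ v → (cmDatum L 2 Φ).toLocal w y ∈ cmLocalIntegralLevel L 2 Φ w then
          f (UnitaryGroup.archPart (↥(maximalRealSubfield L)) L (IsCMField.complexConj L) 2 Φ y) else 0) * B (ρ ((cmDatum L 2 Φ).toLocal v y) u) u) →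
      ∀ (i : 𝔓.ι) [MeasurableSpace (𝔓.radical i)] [BorelSpace (𝔓.radical i)] (νN : Measure (𝔓.radical i)) [νN.IsHaarMeasure] (x y : (cmDatum L 2 Φ).Adelic),
        ∫ n, φ (x * ((n : 𝔓.radical i) : (cmDatum L 2 Φ).Adelic)⁻¹ * y) ∂νN = 0)
    -- (B) finite covolume of `N_i(K)` in `N_i(𝔸)`
    (hB : ∀ (i : 𝔓.ι) [MeasurableSpace (𝔓.radical i)] [BorelSpace (𝔓.radical i)] (νN : Measure (𝔓.radical i)) [νN.IsHaarMeasure] (𝓕 : Set (𝔓.radical i)),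
      IsFundamentalDomain (𝔓.rational i) 𝓕 νN → νN 𝓕 < ∞)
    -- (H4) Gelfand–Graev–Piatetski-Shapiro, BY NAME
    (hH4 : (adelicGroupData (↥(maximalRealSubfield L)) L (IsCMField.complexConj L) 2 Φ).CuspidalSpectrumDiscrete μH 𝔓)
    -- (T) the finite-component ∕ Flath token
    (hTok : ∀ P : DiscreteAutomorphicRep (adelicGroupData (↥(maximalRealSubfield L)) L (IsCMField.complexConj L) 2 Φ) μH,
      (∃ f : V →ₗ[ℂ] P.space.toSubmodule, f ≠ 0 ∧ ∀ (g : (cmDatum L 2 Φ).Local v) (x : V), f (ρ g x) = P.space.toContRep ((((MonoidHom.id ((cmDatum L 2 Φ).Adelic)).comp ((inclPlaceAdelic (↥(maximalRealSubfield L)) L (IsCMField.complexConj L) 2 Φ v).comp (localPiEquiv L (IsCMField.complexConj L) 2 Φ v).symm.toMulEquiv.toMonoidHom)).comp (MonoidHom.id ((cmDatum L 2 Φ).Local v))) g) (f x)) →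
      (∀ w, w ≠ v → ∃ Kw : Subgroup ((cmDatum L 2 Φ).Local w), IsOpen (Kw : Set ((cmDatum L 2 Φ).Local w)) ∧
        IsCompact (Kw : Set ((cmDatum L 2 Φ).Local w)) ∧
          ∃ x : P.space.toSubmodule, x ≠ 0 ∧ ∀ k ∈ Kw, P.space.toContRep ((((MonoidHom.id ((cmDatum L 2 Φ).Adelic)).comp ((inclPlaceAdelic (↥(maximalRealSubfield L)) L (IsCMField.complexConj L) 2 Φ w).comp (localPiEquiv L (IsCMField.complexConj L) 2 Φ w).symm.toMulEquiv.toMonoidHom)).comp (MonoidHom.id ((cmDatum L 2 Φ).Local w))) k) x = x) →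
      ∃ π : ∀ w : HeightOneSpectrum (𝓞 ↥(maximalRealSubfield L)), IrrClass ((cmDatum L 2 Φ).Local w),
        cmOccursInDiscreteSpectrum L 2 Φ μH π ∧
          π v = IrrClass.mk { V := V, ρ := ρ, isIrreducible := inferInstance, isSmooth := hadm.isSmooth } ∧
          ∀ w, w ≠ v → ∃ Kw : Subgroup ((cmDatum L 2 Φ).Local w), IsOpen (Kw : Set ((cmDatum L 2 Φ).Local w)) ∧
            IsCompact (Kw : Set ((cmDatum L 2 Φ).Local w)) ∧ (π w).IsSpherical Kw) :
    ∃ (μH' : Measure (adelicGroupData (↥(maximalRealSubfield L)) L (IsCMField.complexConj L) 2 Φ).automorphicQuotient)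
      (_ : (adelicGroupData (↥(maximalRealSubfield L)) L (IsCMField.complexConj L) 2 Φ).IsAutomorphicMeasure μH')
      (π : ∀ w : HeightOneSpectrum (𝓞 ↥(maximalRealSubfield L)), IrrClass ((cmDatum L 2 Φ).Local w)),
      cmOccursInDiscreteSpectrum L 2 Φ μH' π ∧
        π v = IrrClass.mk { V := V, ρ := ρ, isIrreducible := inferInstance, isSmooth := hadm.isSmooth } ∧
        ∀ w, w ≠ v → ∃ Kw : Subgroup ((cmDatum L 2 Φ).Local w), IsOpen (Kw : Set ((cmDatum L 2 Φ).Local w)) ∧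
          IsCompact (Kw : Set ((cmDatum L 2 Φ).Local w)) ∧ (π w).IsSpherical Kw := by
  -- the automorphic measure, keyed on `cmDatum` (★ `adelicGroupData_eq_cmDatum` is `rfl`, but instance search does not unfold it)
  haveI : (cmDatum L 2 Φ).IsAutomorphicMeasure μH := ‹(adelicGroupData (↥(maximalRealSubfield L)) L (IsCMField.complexConj L) 2 Φ).IsAutomorphicMeasure μH›
  -- rung-1 instances on `U(Φ)(L⁺) ≤ U(Φ)(𝔸)`: discrete, countable, closed; counting measure Radon; the quotient σ-algebra
  have hdisc : (cmDatum L 2 Φ).IsDiscreteRational := cmDatum_isDiscreteRational L 2 Φ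
  haveI := discreteTopology_quotientSubgroup_of_center'_eq_bot (cmDatum L 2 Φ) rfl hdisc
  haveI := countable_quotientSubgroup_of_center'_eq_bot (cmDatum L 2 Φ) rfl hdisc
  haveI : IsClosed (((cmDatum L 2 Φ).quotientSubgroup : Subgroup (cmDatum L 2 Φ).Adelic) : Set (cmDatum L 2 Φ).Adelic) :=
    isClosed_quotientSubgroup_of_center'_eq_bot (cmDatum L 2 Φ) rfl hdisc
  haveI : IsFiniteMeasureOnCompacts (Measure.count : Measure (cmDatum L 2 Φ).quotientSubgroup) :=
    ⟨fun _ hK => Measure.count_apply_lt_top.2 hK.finite_of_discrete⟩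
  letI := (cmDatum L 2 Φ).measurableSpaceQuotientForm
  haveI := (cmDatum L 2 Φ).borelSpaceQuotientForm
  -- (H1): the Poincaré vector of `c_u ⊗ 𝟙_{K^v} ⊗ f` (★ p855494)
  obtain ⟨f, φ, -, -, -, hφ, -, hF0, hFe, hFK⟩ := exists_h1Package_poincare L Φ v hBinv μH hadm hsc hZ hBsymm hBpos ν hu e he hjv
  -- (H2): it is cuspidal (★ p855440, from (A) for this `φ` and (B))
  have hFcusp := toLp_poincare_mem_cuspidalSubspace (cmDatum L 2 Φ) μH 𝔓 rfl hdisc φ (hA f φ hφ) hB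
    (memLp_fiberIntegralVec_quotientSubgroup (cmDatum L 2 Φ) μH (Measure.count : Measure (cmDatum L 2 Φ).quotientSubgroup) φ 2)
  -- the levels `U(Φ)(𝒪_w)` at `w ≠ v` are compact open
  have hFK' : ∀ w, w ≠ v → ∃ Kw : Subgroup ((cmDatum L 2 Φ).Local w), IsOpen (Kw : Set ((cmDatum L 2 Φ).Local w)) ∧
      IsCompact (Kw : Set ((cmDatum L 2 Φ).Local w)) ∧ ∀ k ∈ Kw, (cmDatum L 2 Φ).rightRegular μH ((((MonoidHom.id ((cmDatum L 2 Φ).Adelic)).comp ((inclPlaceAdelic (↥(maximalRealSubfield L)) L (IsCMField.complexConj L) 2 Φ w).comp (localPiEquiv L (IsCMField.complexConj L) 2 Φ w).symm.toMulEquiv.toMonoidHom)).comp (MonoidHom.id ((cmDatum L 2 Φ).Local w))) k)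
        ((memLp_fiberIntegralVec_quotientSubgroup (cmDatum L 2 Φ) μH (Measure.count : Measure (cmDatum L 2 Φ).quotientSubgroup) φ 2).toLp _) =
        (memLp_fiberIntegralVec_quotientSubgroup (cmDatum L 2 Φ) μH (Measure.count : Measure (cmDatum L 2 Φ).quotientSubgroup) φ 2).toLp _ :=
    fun w hw => ⟨cmLocalIntegralLevel L 2 Φ w, (isCompact_isOpen_cmLocalIntegralLevel L 2 Φ w).2, (isCompact_isOpen_cmLocalIntegralLevel L 2 Φ w).1, hFK w hw⟩
  -- ★ p855363 with `jl := j` (the two currencies `cmDatum L 2 Φ` ∕ `adelicGroupData L⁺ L c 2 Φ` agree definitionally, ★ `adelicGroupData_eq_cmDatum`)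
  exact globaliseSupercuspidal_of_cuspidal L Φ v hadm hsc hZ hBsymm hBpos hBinv ν hu e he μH (fun w => (((MonoidHom.id ((cmDatum L 2 Φ).Adelic)).comp ((inclPlaceAdelic (↥(maximalRealSubfield L)) L (IsCMField.complexConj L) 2 Φ w).comp (localPiEquiv L (IsCMField.complexConj L) 2 Φ w).symm.toMulEquiv.toMonoidHom)).comp (MonoidHom.id ((cmDatum L 2 Φ).Local w)))) 𝔓 hjv
    ((memLp_fiberIntegralVec_quotientSubgroup (cmDatum L 2 Φ) μH (Measure.count : Measure (cmDatum L 2 Φ).quotientSubgroup) φ 2).toLp _) hF0 hFe hFK' hFcusp hH4 hTok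

end General

end Summit.HodgeConjecture.HodgeConjecture.Cruxes.H413.K2E1GlobaliseSupercuspidalU2Poincare

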